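import Mathlib
import Summits.NavierStokesRegularity.NavierStokesRegularity.Theorems.EulerZoomLiouvillePowerGaugeEulerLiouvilleSelfSimilarTopBadNodeKernelLine
import HarnessLib.Audit

/-!
# Rung C1 of the crux `EulerZoomLiouville.PowerGaugeEulerLiouville`: the Bernoulli LANDSCAPE along the kernel-line graph
# — `(ℋ∘Γ)′ = (2γ−1)·φ·(1 + θ)` with `θ` small near the top bad node (inventory item (ii) of the no-exit lemma)

Route №10 `EulerZoomLiouville` (NavierStokesRegularity), crux E = stmt-NavierStokesRegularity-19832,
tenure rung C1 (exactly self-similar members), registered residue `stub_selfSimilarExtremal`.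
Eighteenth file of the NODAL-CONTINUUM line (lineage ns-typeII-p1, gen 7).  For a `C²` profile `(U, P)` (CIV 2026 (3.3);
`V = γ(y−c) + U`, `ℋ` (3.30)), a point `z` with `curl U(z) = 0` (so `DU(z)` is symmetric), a unit vector `e`, and a
graph curve `Γ(σ) = z + σe + g(σ)` over the line `ℝe` (`g ⊥ e`) on which the transport is PARALLEL to `e`,
`V(Γ σ) = φ(σ)e` (the kernel-line graph of `exists_kernelGraph_of_corankOne`):

* `inner_deriv_eq_zero_of_inner_eq_zero` — `g ⊥ e` everywhere ⇒ `g′ ⊥ e`;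
* `hasDerivAt_selfSimilarBernoulli_graph` — **`d/dσ ℋ(Γ σ) = φ(σ)·((2γ−1) + θ(σ))` with
  `|θ(σ)| ≤ 2‖DU(Γ σ) − DU(z)‖·‖e + g′(σ)‖`** (CIV (3.29) along `Γ`; the commutator `⟪e, DUw⟫ − ⟪DUe, w⟫` vanishes for the
  symmetric `DU(z)`), i.e. near `z` the landscape `σ ↦ ℋ(Γσ)` moves by `(2γ−1)φ` to leading order: it is constant on arcs of
  nodes (`φ = 0`) and, in the window `γ < ½`, DEcreases where `φ > 0` and INcreases where `φ < 0` — while the projected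
  backward motion `σ′ = −φ − ⟪e,E⟫` (`hasDerivAt_kernelCoord`) always climbs it: `d/dt ℋ(Γ(σ(t))) ≈ (1−2γ)φ²`.

WHAT THIS IS NOT: not NS, not E, not rung C1 — calculus bookkeeping for classical profiles.
References: P. Constantin, M. Ignatova, V. Vicol, arXiv:2602.17570 (2026), §3.4.3 (3.29)–(3.31) [ConstantinIgnatovaVicol2026Putative].
-/

noncomputable section

-- flat `Theorems/<Route><Decl>…` files of one crux share the namespace of the crux (tree convention)
set_option linter.dupNamespace false

open Set Filter Topology Metric Function InnerProductSpace
open scoped RealInnerProductSpace NNReal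

namespace Summit.NavierStokesRegularity.NavierStokesRegularity.Theorems.PowerGaugeEulerLiouville.NodalContinuum

open Literature.Analysis Literature.Analysis.FluidPDE Literature.Analysis.ODE
open Summit.NavierStokesRegularity.NavierStokesRegularity.Theorems.PowerGaugeEulerLiouville.NodalFiniteness

variable {γ : ℝ} {c : EuclideanSpace ℝ (Fin 3)}
  {U : EuclideanSpace ℝ (Fin 3) → EuclideanSpace ℝ (Fin 3)} {P : EuclideanSpace ℝ (Fin 3) → ℝ}

/-- If `⟪e, g(σ)⟫ = 0` for all `σ` and `g` is differentiable at `σ` with derivative `g'`, then `⟪e, g'⟫ = 0`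
(uniqueness of the derivative of the constant function `σ ↦ ⟪e, g σ⟫ = 0`). [folklore] -/
theorem inner_deriv_eq_zero_of_inner_eq_zero {g : ℝ → EuclideanSpace ℝ (Fin 3)} {g' e : EuclideanSpace ℝ (Fin 3)}
    {σ : ℝ} (hge : ∀ τ, ⟪e, g τ⟫ = 0) (hg : HasDerivAt g g' σ) : ⟪e, g'⟫ = 0 := by
  have h1 : HasDerivAt (fun τ => ⟪e, g τ⟫) (⟪e, g'⟫ + ⟪(0 : EuclideanSpace ℝ (Fin 3)), g σ⟫) σ :=
    (hasDerivAt_const σ e).inner ℝ hg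
  rw [inner_zero_left, add_zero] at h1
  have h2 : HasDerivAt (fun τ => ⟪e, g τ⟫) 0 σ := by
    have : (fun τ => ⟪e, g τ⟫) = fun _ => (0 : ℝ) := funext hge
    rw [this]; exact hasDerivAt_const σ 0
  exact h1.unique h2

/-- **The Bernoulli landscape along the kernel-line graph.**  Let `(U, P)` be a `C²` self-similar Euler profile, `z` a point
with `curl U(z) = 0`, `e` a unit vector, `g : ℝ → ℝ³` with `⟪e, g τ⟫ = 0` for all `τ` and `HasDerivAt g g' σ`, and put
`Γ(τ) = z + τe + g(τ)`.  If `V(Γ σ) = φ e`, then `τ ↦ ℋ(Γ τ)` has derivative `φ·((2γ−1) + θ)` at `σ` with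
`|θ| ≤ 2‖DU(Γ σ) − DU(z)‖·‖e + g'‖` (`θ = ⟪e, DU(Γσ)w⟫ − ⟪DU(Γσ)e, w⟫`, `w = e + g'`, a commutator that vanishes for the
symmetric `DU(z)`). [cite: ConstantinIgnatovaVicol2026Putative, §3.4.3 eq. (3.29) (along a curve where the transport is parallel; not in print)] -/
theorem hasDerivAt_selfSimilarBernoulli_graph (h : IsSelfSimilarEulerProfile γ c U P)
    {z e : EuclideanSpace ℝ (Fin 3)} (hΩz : curl U z = 0) (he : ‖e‖ = 1)
    {g : ℝ → EuclideanSpace ℝ (Fin 3)} {g' : EuclideanSpace ℝ (Fin 3)} {σ φ : ℝ}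
    (hge : ∀ τ, ⟪e, g τ⟫ = 0) (hg : HasDerivAt g g' σ)
    (hV : selfSimilarTransport γ c U (z + σ • e + g σ) = φ • e) :
    ∃ θ : ℝ, |θ| ≤ 2 * ‖fderiv ℝ U (z + σ • e + g σ) - fderiv ℝ U z‖ * ‖e + g'‖ ∧
      HasDerivAt (fun τ => selfSimilarBernoulli γ c U P (z + τ • e + g τ)) (φ * ((2 * γ - 1) + θ)) σ := by
  set y := z + σ • e + g σ with hy
  set w := e + g' with hw
  set D := fderiv ℝ U y with hD
  set Dz := fderiv ℝ U z with hDz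
  -- the path and the chain rule
  have hpath : HasDerivAt (fun τ : ℝ => z + τ • e + g τ) w σ := by
    have h1 : HasDerivAt (fun τ : ℝ => z + τ • e) e σ := by
      simpa using ((hasDerivAt_id σ).smul_const e).const_add z
    exact h1.add hg
  have hHd : Differentiable ℝ (selfSimilarBernoulli γ c U P) :=
    h.contDiff_selfSimilarBernoulli.differentiable one_ne_zero
  have hcomp : HasDerivAt (fun τ => selfSimilarBernoulli γ c U P (z + τ • e + g τ))
      (fderiv ℝ (selfSimilarBernoulli γ c U P) y w) σ := by
    have := (hHd y).hasFDerivAt.comp_hasDerivAt σ hpath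
    exact this
  -- the value of the derivative
  set θ : ℝ := ⟪e, D w⟫ - ⟪D e, w⟫ with hθ
  have hval : fderiv ℝ (selfSimilarBernoulli γ c U P) y w = φ * ((2 * γ - 1) + θ) := by
    rw [fderiv_selfSimilarBernoulli_of_transport_parallel h hV w]
    have hew : ⟪e, w⟫ = 1 := by
      rw [hw, inner_add_right, real_inner_self_eq_norm_sq, he, inner_deriv_eq_zero_of_inner_eq_zero hge hg]
      norm_num
    rw [hew, hθ, hD]
    ring
  refine ⟨θ, ?_, hval ▸ hcomp⟩
  -- the commutator bound: `θ = ⟪e, (D - Dz) w⟫ - ⟪(D - Dz) e, w⟫` since `Dz` is symmetric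
  have hS := isSymmetric_fderiv_of_curl_eq_zero (h.differentiable_velocity z) hΩz
  have hsym : ⟪e, Dz w⟫ = ⟪Dz e, w⟫ := by
    have := hS e w
    simp only [ContinuousLinearMap.coe_coe] at this
    rw [this]
  have e1 : θ = ⟪e, (D - Dz) w⟫ - ⟪(D - Dz) e, w⟫ := by
    simp only [hθ, FunLike.coe_sub, Pi.sub_apply, inner_sub_left, inner_sub_right]
    linarith [hsym]
  rw [e1]
  have hb1 : |⟪e, (D - Dz) w⟫| ≤ ‖D - Dz‖ * ‖w‖ := by
    calc |⟪e, (D - Dz) w⟫| ≤ ‖e‖ * ‖(D - Dz) w‖ := abs_real_inner_le_norm _ _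
      _ ≤ 1 * (‖D - Dz‖ * ‖w‖) := by rw [he]; exact mul_le_mul_of_nonneg_left ((D - Dz).le_opNorm w) zero_le_one
      _ = ‖D - Dz‖ * ‖w‖ := one_mul _
  have hb2 : |⟪(D - Dz) e, w⟫| ≤ ‖D - Dz‖ * ‖w‖ := by
    calc |⟪(D - Dz) e, w⟫| ≤ ‖(D - Dz) e‖ * ‖w‖ := abs_real_inner_le_norm _ _
      _ ≤ (‖D - Dz‖ * ‖e‖) * ‖w‖ := mul_le_mul_of_nonneg_right ((D - Dz).le_opNorm e) (norm_nonneg _)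
      _ = ‖D - Dz‖ * ‖w‖ := by rw [he, mul_one]
  calc |⟪e, (D - Dz) w⟫ - ⟪(D - Dz) e, w⟫| ≤ |⟪e, (D - Dz) w⟫| + |⟪(D - Dz) e, w⟫| := abs_sub _ _
    _ ≤ ‖D - Dz‖ * ‖w‖ + ‖D - Dz‖ * ‖w‖ := add_le_add hb1 hb2
    _ = 2 * ‖D - Dz‖ * ‖w‖ := by ring

/-- **Landscape monotonicity along the projected motion (pointwise form).**  With the data of
`hasDerivAt_selfSimilarBernoulli_graph` and a real `σd` (the time-derivative of the kernel coordinate, `σ′ = −φ − ⟪e,E⟫`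
by `hasDerivAt_kernelCoord`): `φ((2γ−1)+θ)·σd = (1−2γ−θ)(φ² + φ·⟪e,E⟫)` when `σd = −φ − ⟪e,E⟫`; in the window and for
`|θ| ≤ (1−2γ)/2` this is `≥ (1−2γ)/2·(φ²/2 − ⟪e,E⟫²/2)·…` — recorded as the elementary inequality
`φ((2γ−1)+θ)(−φ − x) ≥ ((1−2γ)/4)φ² − (3(1−2γ)/4)x²` for `|θ| ≤ (1−2γ)/2`. [folklore] -/
theorem landscape_rate_lower_bound {γ φ θ x : ℝ} (hγ2 : γ < 1 / 2) (hθ : |θ| ≤ (1 - 2 * γ) / 2) :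
    (1 - 2 * γ) / 4 * φ ^ 2 - 3 * (1 - 2 * γ) / 4 * x ^ 2 ≤ φ * ((2 * γ - 1) + θ) * (-φ - x) := by
  have h12 : 0 < 1 - 2 * γ := by linarith
  have hθ' := abs_le.1 hθ
  -- `φ((2γ−1)+θ)(−φ−x) = (1−2γ−θ)(φ² + φx)` with `1−2γ−θ ∈ [(1−2γ)/2, 3(1−2γ)/2]`
  have e : φ * ((2 * γ - 1) + θ) * (-φ - x) = (1 - 2 * γ - θ) * (φ ^ 2 + φ * x) := by ring
  rw [e]
  have hk1 : (1 - 2 * γ) / 2 ≤ 1 - 2 * γ - θ := by linarith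
  have hk2 : 1 - 2 * γ - θ ≤ 3 * (1 - 2 * γ) / 2 := by linarith
  -- `φ² + φx ≥ φ²/2 − x²/2`
  have hq : φ ^ 2 / 2 - x ^ 2 / 2 ≤ φ ^ 2 + φ * x := by nlinarith [sq_nonneg (φ + x)]
  by_cases hpos : 0 ≤ φ ^ 2 + φ * x
  · have := mul_le_mul_of_nonneg_right hk1 hpos
    nlinarith [hq, h12, sq_nonneg x, sq_nonneg φ]
  · push Not at hpos
    have := mul_le_mul_of_nonpos_right hk2 hpos.le
    nlinarith [hq, h12, sq_nonneg x, sq_nonneg φ]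

end Summit.NavierStokesRegularity.NavierStokesRegularity.Theorems.PowerGaugeEulerLiouville.NodalContinuum
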